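import Summits.Parity.GeneralizedHardyLittlewood.Theorems.PrimeLevelFamEdgeMomentsBeyondDiagonalDiagRemThreeThreeMonomials
import HarnessLib

/-!
# Route `PrimeLevelFamEdge`, crux K_A `MomentsBeyondDiagonal` (stmt-Parity-20007), line «petersson_layers» v4, stub `stub_diag`:
# **the monomial bookkeeping of the order-`(2,4)` remainder weight** (brick B3 of the remainder estimate (R₂₄), abstract form)

Brick B3 of the order-`(2,4)` remainder estimate (R₂₄) — the hypothesis `hR` of `…DiagOrderTwoFourOfR24.orderTwoFour_target_of_remainder`
(lineage famedge-2 g7). For fixed Selberg coordinates `(c,g)` the Hecke-summed remainder weight of order `(2,4)` is a combination of the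
fifteen kernels `r_ab(αk₁k₂)`, `a ≤ 2`, `b ≤ 4`, with polynomial prefactors in `L = 2β + ℓ⁺(k₁) + ℓ⁺(k₂)`, `S₂ = P2(k₁) + P2(k₂)`,
`S₄`, `S₆` of homogeneous weight `6` — the order-`(2,4)` twin of `…DiagRemThreeThreeMonomials` (p833817): by the generic `L`-power lemma
`…DiagRemTwoTwoLpow.abs_Lpow_monomial_le` the weight is `59` terms — undecorated (`Σ|c|4ᵖΛᵖ ≤ 729Λ⁶`, envelope `Ψ₀`), one-sided `P2`
(`≤ 140Λ⁴`, `Ψ₂`), one-sided `3P2²−2P4` (`≤ 5Λ²`, `Ψ₄`), one-sided `15P2³−30P2P4+16P6` (`1/32`, `Ψ₆`), both-sided `P2⊗P2` (`≤ 15Λ²`,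
`Ψ_B`) and the mixed both-sided `P2⊗(3P2²−2P4)` (`15/32`, `Ψ_BD`); all constants are below the order-`(3,3)` ones, so the bound is
stated with the SAME envelope combination `729Λ⁶Ψ₀ + 140Λ⁴Ψ₂ + 5Λ²Ψ₄ + Ψ₆ + 15Λ²Ψ_B + Ψ_BD` (and the inner estimate of (R₂₄) can
reuse `…DiagRemThreeThreeEnvelopeArith.envelope_arith₃₃` verbatim).

* `abs_monomial_weight_le₂₄` — **one profile monomial `ℓ⁺(k₁)^{m₁}ℓ⁺(k₂)^{m₂}` against `Wt₂₄`:
  `≤ (729Λ⁶Ψ₀ + 140Λ⁴Ψ₂ + 5Λ²Ψ₄ + Ψ₆ + 15Λ²Ψ_B + Ψ_BD)·log^{m₁+m₂}Y`.**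

Def-free; theorems only. Helper `--supports stmt-Parity-20007`; closes nothing; K_A, K_B and the Parity summit are NOT proved;
nothing about Landau–Siegel zeros.

## References
* E. Kowalski, P. Michel, J. VanderKam, J. reine angew. Math. 526 (2000), (22)–(28) pp. 12–15 and Prop. 5.1 p. 18.
  [cite: KowalskiMichelVanderKam2000, (23)–(28) — derivation (order-(2,4) remainder weight, monomial bookkeeping)]
-/

noncomputable section

open Finset Real Polynomial

namespace Summit.Parity.GeneralizedHardyLittlewood.Theorems.MomentsBeyondDiagonal.DiagCorner

open Summit.Parity.GeneralizedHardyLittlewood.Theorems.BeyondDiagonalBeatsQuarter.Corner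

set_option maxHeartbeats 4000000 in
-- 59 monomial bounds combined by `linarith`
/-- **One monomial `ℓ⁺(k₁)^{m₁}ℓ⁺(k₂)^{m₂}` (`m₁, m₂ ≥ 1`) against the order-`(2,4)` remainder weight `Wt₂₄`** (module docstring).
[cite: KowalskiMichelVanderKam2000, (23)–(28) — derivation (order-(2,4) remainder weight, one monomial)] -/
theorem abs_monomial_weight_le₂₄ {a P2 P4 P6 : ℕ → ℝ}
    {R₀₀ R₀₁ R₀₂ R₀₃ R₀₄ R₁₀ R₁₁ R₁₂ R₁₃ R₁₄ R₂₀ R₂₁ R₂₂ R₂₃ R₂₄ : ℝ → ℝ}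
    {Y α β Λ Ψ₀ Ψ₂ Ψ₄ Ψ₆ ΨB ΨBD : ℝ} {m₁ m₂ : ℕ}
    (hm₁ : 1 ≤ m₁) (hm₂ : 1 ≤ m₂) (hY : 1 ≤ Y) (hΛ : 1 ≤ Λ) (hβ : |β| ≤ Λ) (hLY : Real.log Y ≤ Λ)
    (hΨ₀ : 0 ≤ Ψ₀) (hΨ₂ : 0 ≤ Ψ₂) (hΨ₄ : 0 ≤ Ψ₄) (hΨ₆ : 0 ≤ Ψ₆) (hΨB : 0 ≤ ΨB) (hΨBD : 0 ≤ ΨBD)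
    (h0 : ∀ R : ℝ → ℝ, (R = R₀₀ ∨ R = R₀₁ ∨ R = R₀₂ ∨ R = R₀₃ ∨ R = R₀₄ ∨ R = R₁₀ ∨ R = R₁₁ ∨ R = R₁₂ ∨ R = R₁₃ ∨ R = R₁₄ ∨ R = R₂₀ ∨ R = R₂₁ ∨ R = R₂₂ ∨ R = R₂₃ ∨ R = R₂₄) →
      ∀ i j : ℕ, 1 ≤ i → 1 ≤ j →
      |∑ k₁ ∈ Icc 1 ⌊Y⌋₊, ∑ k₂ ∈ Icc 1 ⌊Y⌋₊,
          a k₁ * a k₂ * ellp Y k₁ ^ i * ellp Y k₂ ^ j * R (α * k₁ * k₂)| ≤ Real.log Y ^ (i + j) * Ψ₀)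
    (h2 : ∀ R : ℝ → ℝ, (R = R₀₀ ∨ R = R₀₁ ∨ R = R₀₂ ∨ R = R₀₃ ∨ R = R₀₄ ∨ R = R₁₀ ∨ R = R₁₂ ∨ R = R₁₃ ∨ R = R₂₀ ∨ R = R₂₁ ∨ R = R₂₂) →
      ∀ i j : ℕ, 1 ≤ i → 1 ≤ j →
      |∑ k₁ ∈ Icc 1 ⌊Y⌋₊, ∑ k₂ ∈ Icc 1 ⌊Y⌋₊,
          a k₁ * (a k₂ * P2 k₂) * ellp Y k₁ ^ i * ellp Y k₂ ^ j * R (α * k₁ * k₂)| ≤ Real.log Y ^ (i + j) * Ψ₂)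
    (h4 : ∀ R : ℝ → ℝ, (R = R₀₀ ∨ R = R₀₁ ∨ R = R₀₂ ∨ R = R₁₀ ∨ R = R₁₁ ∨ R = R₂₀) →
      ∀ i j : ℕ, 1 ≤ i → 1 ≤ j →
      |∑ k₁ ∈ Icc 1 ⌊Y⌋₊, ∑ k₂ ∈ Icc 1 ⌊Y⌋₊,
          a k₁ * (a k₂ * (3 * P2 k₂ ^ 2 - 2 * P4 k₂)) * ellp Y k₁ ^ i * ellp Y k₂ ^ j * R (α * k₁ * k₂)| ≤
        Real.log Y ^ (i + j) * Ψ₄)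
    (h6 : ∀ i j : ℕ, 1 ≤ i → 1 ≤ j →
      |∑ k₁ ∈ Icc 1 ⌊Y⌋₊, ∑ k₂ ∈ Icc 1 ⌊Y⌋₊,
          a k₁ * (a k₂ * (15 * P2 k₂ ^ 3 - 30 * P2 k₂ * P4 k₂ + 16 * P6 k₂)) * ellp Y k₁ ^ i * ellp Y k₂ ^ j *
            R₀₀ (α * k₁ * k₂)| ≤ Real.log Y ^ (i + j) * Ψ₆)
    (hB : ∀ R : ℝ → ℝ, (R = R₀₀ ∨ R = R₀₁ ∨ R = R₀₂ ∨ R = R₁₀ ∨ R = R₁₁ ∨ R = R₂₀) →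
      ∀ i j : ℕ, 1 ≤ i → 1 ≤ j →
      |∑ k₁ ∈ Icc 1 ⌊Y⌋₊, ∑ k₂ ∈ Icc 1 ⌊Y⌋₊,
          (a k₁ * P2 k₁) * (a k₂ * P2 k₂) * ellp Y k₁ ^ i * ellp Y k₂ ^ j * R (α * k₁ * k₂)| ≤
        Real.log Y ^ (i + j) * ΨB)
    (hBD : ∀ i j : ℕ, 1 ≤ i → 1 ≤ j →
      |∑ k₁ ∈ Icc 1 ⌊Y⌋₊, ∑ k₂ ∈ Icc 1 ⌊Y⌋₊,
          (a k₁ * P2 k₁) * (a k₂ * (3 * P2 k₂ ^ 2 - 2 * P4 k₂)) * ellp Y k₁ ^ i * ellp Y k₂ ^ j * R₀₀ (α * k₁ * k₂)| ≤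
        Real.log Y ^ (i + j) * ΨBD) :
    |∑ k₁ ∈ Icc 1 ⌊Y⌋₊, ∑ k₂ ∈ Icc 1 ⌊Y⌋₊,
        a k₁ * a k₂ * ellp Y k₁ ^ m₁ * ellp Y k₂ ^ m₂ *
          (((2 * β + ellp Y k₁ + ellp Y k₂) ^ 6 - (2 * β + ellp Y k₁ + ellp Y k₂) ^ 4 * (P2 k₁ + P2 k₂) - 3 * (2 * β + ellp Y k₁ + ellp Y k₂) ^ 2 * (P2 k₁ + P2 k₂) ^ 2 + 2 * (2 * β + ellp Y k₁ + ellp Y k₂) ^ 2 * (P4 k₁ + P4 k₂) + 15 * (P2 k₁ + P2 k₂) ^ 3 - 30 * (P2 k₁ + P2 k₂) * (P4 k₁ + P4 k₂) + 16 * (P6 k₁ + P6 k₂)) / 64 * R₀₀ (α * k₁ * k₂) +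
            ((2 * β + ellp Y k₁ + ellp Y k₂) ^ 5 - 2 * (2 * β + ellp Y k₁ + ellp Y k₂) ^ 3 * (P2 k₁ + P2 k₂) + 3 * (2 * β + ellp Y k₁ + ellp Y k₂) * (P2 k₁ + P2 k₂) ^ 2 - 2 * (2 * β + ellp Y k₁ + ellp Y k₂) * (P4 k₁ + P4 k₂)) / 8 * R₀₁ (α * k₁ * k₂) +
            (3 * (2 * β + ellp Y k₁ + ellp Y k₂) ^ 4 - 6 * (2 * β + ellp Y k₁ + ellp Y k₂) ^ 2 * (P2 k₁ + P2 k₂) + 9 * (P2 k₁ + P2 k₂) ^ 2 - 6 * (P4 k₁ + P4 k₂)) / 8 * R₀₂ (α * k₁ * k₂) +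
            ((2 * β + ellp Y k₁ + ellp Y k₂) ^ 3 - (2 * β + ellp Y k₁ + ellp Y k₂) * (P2 k₁ + P2 k₂)) / 2 * R₀₃ (α * k₁ * k₂) +
            ((2 * β + ellp Y k₁ + ellp Y k₂) ^ 2 + (P2 k₁ + P2 k₂)) / 4 * R₀₄ (α * k₁ * k₂) +
            ((2 * β + ellp Y k₁ + ellp Y k₂) ^ 5 + 2 * (2 * β + ellp Y k₁ + ellp Y k₂) ^ 3 * (P2 k₁ + P2 k₂) - 9 * (2 * β + ellp Y k₁ + ellp Y k₂) * (P2 k₁ + P2 k₂) ^ 2 + 6 * (2 * β + ellp Y k₁ + ellp Y k₂) * (P4 k₁ + P4 k₂)) / 16 * R₁₀ (α * k₁ * k₂) +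
            ((2 * β + ellp Y k₁ + ellp Y k₂) ^ 4 - 3 * (P2 k₁ + P2 k₂) ^ 2 + 2 * (P4 k₁ + P4 k₂)) / 2 * R₁₁ (α * k₁ * k₂) +
            (3 * (2 * β + ellp Y k₁ + ellp Y k₂) ^ 3 - 3 * (2 * β + ellp Y k₁ + ellp Y k₂) * (P2 k₁ + P2 k₂)) / 2 * R₁₂ (α * k₁ * k₂) +
            (2 * (2 * β + ellp Y k₁ + ellp Y k₂) ^ 2 - 2 * (P2 k₁ + P2 k₂)) * R₁₃ (α * k₁ * k₂) +
            (2 * β + ellp Y k₁ + ellp Y k₂) * R₁₄ (α * k₁ * k₂) +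
            ((2 * β + ellp Y k₁ + ellp Y k₂) ^ 4 + 6 * (2 * β + ellp Y k₁ + ellp Y k₂) ^ 2 * (P2 k₁ + P2 k₂) + 3 * (P2 k₁ + P2 k₂) ^ 2 - 2 * (P4 k₁ + P4 k₂)) / 16 * R₂₀ (α * k₁ * k₂) +
            ((2 * β + ellp Y k₁ + ellp Y k₂) ^ 3 + 3 * (2 * β + ellp Y k₁ + ellp Y k₂) * (P2 k₁ + P2 k₂)) / 2 * R₂₁ (α * k₁ * k₂) +
            (3 * (2 * β + ellp Y k₁ + ellp Y k₂) ^ 2 + 3 * (P2 k₁ + P2 k₂)) / 2 * R₂₂ (α * k₁ * k₂) + 2 * (2 * β + ellp Y k₁ + ellp Y k₂) * R₂₃ (α * k₁ * k₂) + R₂₄ (α * k₁ * k₂))| ≤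
      (729 * Λ ^ 6 * Ψ₀ + 140 * Λ ^ 4 * Ψ₂ + 5 * Λ ^ 2 * Ψ₄ + Ψ₆ + 15 * Λ ^ 2 * ΨB + ΨBD) * Real.log Y ^ (m₁ + m₂) := by
  have hL0 : 0 ≤ Real.log Y := Real.log_nonneg hY
  have hΛ0 : 0 ≤ Λ := zero_le_one.trans hΛ
  set I := Icc 1 ⌊Y⌋₊ with hI
  set X₀ : ℝ := Real.log Y ^ (m₁ + m₂) * Ψ₀ with hX₀
  set X₂ : ℝ := Real.log Y ^ (m₁ + m₂) * Ψ₂ with hX₂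
  set X₄ : ℝ := Real.log Y ^ (m₁ + m₂) * Ψ₄ with hX₄
  set X₆ : ℝ := Real.log Y ^ (m₁ + m₂) * Ψ₆ with hX₆
  set XB : ℝ := Real.log Y ^ (m₁ + m₂) * ΨB with hXB
  set XBD : ℝ := Real.log Y ^ (m₁ + m₂) * ΨBD with hXBD
  have hX₀0 : 0 ≤ X₀ := by positivity
  have hX₂0 : 0 ≤ X₂ := by positivity
  have hX₄0 : 0 ≤ X₄ := by positivity
  have hX₆0 : 0 ≤ X₆ := by positivity
  have hXB0 : 0 ≤ XB := by positivity
  have hXBD0 : 0 ≤ XBD := by positivity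
  have G00 := abs_Lpow_monomial_le hY hΛ hβ hLY hΨ₀ (h0 R₀₀ (Or.inl rfl))
  have G01 := abs_Lpow_monomial_le hY hΛ hβ hLY hΨ₀ (h0 R₀₁ (Or.inr (Or.inl rfl)))
  have G02 := abs_Lpow_monomial_le hY hΛ hβ hLY hΨ₀ (h0 R₀₂ (Or.inr (Or.inr (Or.inl rfl))))
  have G03 := abs_Lpow_monomial_le hY hΛ hβ hLY hΨ₀ (h0 R₀₃ (Or.inr (Or.inr (Or.inr (Or.inl rfl)))))
  have G04 := abs_Lpow_monomial_le hY hΛ hβ hLY hΨ₀ (h0 R₀₄ (Or.inr (Or.inr (Or.inr (Or.inr (Or.inl rfl))))))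
  have G10 := abs_Lpow_monomial_le hY hΛ hβ hLY hΨ₀ (h0 R₁₀ (Or.inr (Or.inr (Or.inr (Or.inr (Or.inr (Or.inl rfl)))))))
  have G11 := abs_Lpow_monomial_le hY hΛ hβ hLY hΨ₀ (h0 R₁₁ (Or.inr (Or.inr (Or.inr (Or.inr (Or.inr (Or.inr (Or.inl rfl))))))))
  have G12 := abs_Lpow_monomial_le hY hΛ hβ hLY hΨ₀ (h0 R₁₂ (Or.inr (Or.inr (Or.inr (Or.inr (Or.inr (Or.inr (Or.inr (Or.inl rfl)))))))))
  have G13 := abs_Lpow_monomial_le hY hΛ hβ hLY hΨ₀ (h0 R₁₃ (Or.inr (Or.inr (Or.inr (Or.inr (Or.inr (Or.inr (Or.inr (Or.inr (Or.inl rfl))))))))))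
  have G14 := abs_Lpow_monomial_le hY hΛ hβ hLY hΨ₀ (h0 R₁₄ (Or.inr (Or.inr (Or.inr (Or.inr (Or.inr (Or.inr (Or.inr (Or.inr (Or.inr (Or.inl rfl)))))))))))
  have G20 := abs_Lpow_monomial_le hY hΛ hβ hLY hΨ₀ (h0 R₂₀ (Or.inr (Or.inr (Or.inr (Or.inr (Or.inr (Or.inr (Or.inr (Or.inr (Or.inr (Or.inr (Or.inl rfl))))))))))))
  have G21 := abs_Lpow_monomial_le hY hΛ hβ hLY hΨ₀ (h0 R₂₁ (Or.inr (Or.inr (Or.inr (Or.inr (Or.inr (Or.inr (Or.inr (Or.inr (Or.inr (Or.inr (Or.inr (Or.inl rfl)))))))))))))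
  have G22 := abs_Lpow_monomial_le hY hΛ hβ hLY hΨ₀ (h0 R₂₂ (Or.inr (Or.inr (Or.inr (Or.inr (Or.inr (Or.inr (Or.inr (Or.inr (Or.inr (Or.inr (Or.inr (Or.inr (Or.inl rfl))))))))))))))
  have G23 := abs_Lpow_monomial_le hY hΛ hβ hLY hΨ₀ (h0 R₂₃ (Or.inr (Or.inr (Or.inr (Or.inr (Or.inr (Or.inr (Or.inr (Or.inr (Or.inr (Or.inr (Or.inr (Or.inr (Or.inr (Or.inl rfl)))))))))))))))
  have G24 := abs_Lpow_monomial_le hY hΛ hβ hLY hΨ₀ (h0 R₂₄ (Or.inr (Or.inr (Or.inr (Or.inr (Or.inr (Or.inr (Or.inr (Or.inr (Or.inr (Or.inr (Or.inr (Or.inr (Or.inr (Or.inr rfl)))))))))))))))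
  have P00 := abs_Lpow_monomial_le hY hΛ hβ hLY hΨ₂ (h2 R₀₀ (Or.inl rfl))
  have P01 := abs_Lpow_monomial_le hY hΛ hβ hLY hΨ₂ (h2 R₀₁ (Or.inr (Or.inl rfl)))
  have P02 := abs_Lpow_monomial_le hY hΛ hβ hLY hΨ₂ (h2 R₀₂ (Or.inr (Or.inr (Or.inl rfl))))
  have P03 := abs_Lpow_monomial_le hY hΛ hβ hLY hΨ₂ (h2 R₀₃ (Or.inr (Or.inr (Or.inr (Or.inl rfl)))))
  have P04 := abs_Lpow_monomial_le hY hΛ hβ hLY hΨ₂ (h2 R₀₄ (Or.inr (Or.inr (Or.inr (Or.inr (Or.inl rfl))))))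
  have P10 := abs_Lpow_monomial_le hY hΛ hβ hLY hΨ₂ (h2 R₁₀ (Or.inr (Or.inr (Or.inr (Or.inr (Or.inr (Or.inl rfl)))))))
  have P12 := abs_Lpow_monomial_le hY hΛ hβ hLY hΨ₂ (h2 R₁₂ (Or.inr (Or.inr (Or.inr (Or.inr (Or.inr (Or.inr (Or.inl rfl))))))))
  have P13 := abs_Lpow_monomial_le hY hΛ hβ hLY hΨ₂ (h2 R₁₃ (Or.inr (Or.inr (Or.inr (Or.inr (Or.inr (Or.inr (Or.inr (Or.inl rfl)))))))))
  have P20 := abs_Lpow_monomial_le hY hΛ hβ hLY hΨ₂ (h2 R₂₀ (Or.inr (Or.inr (Or.inr (Or.inr (Or.inr (Or.inr (Or.inr (Or.inr (Or.inl rfl))))))))))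
  have P21 := abs_Lpow_monomial_le hY hΛ hβ hLY hΨ₂ (h2 R₂₁ (Or.inr (Or.inr (Or.inr (Or.inr (Or.inr (Or.inr (Or.inr (Or.inr (Or.inr (Or.inl rfl)))))))))))
  have P22 := abs_Lpow_monomial_le hY hΛ hβ hLY hΨ₂ (h2 R₂₂ (Or.inr (Or.inr (Or.inr (Or.inr (Or.inr (Or.inr (Or.inr (Or.inr (Or.inr (Or.inr rfl)))))))))))
  have D00 := abs_Lpow_monomial_le hY hΛ hβ hLY hΨ₄ (h4 R₀₀ (Or.inl rfl))
  have D01 := abs_Lpow_monomial_le hY hΛ hβ hLY hΨ₄ (h4 R₀₁ (Or.inr (Or.inl rfl)))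
  have D02 := abs_Lpow_monomial_le hY hΛ hβ hLY hΨ₄ (h4 R₀₂ (Or.inr (Or.inr (Or.inl rfl))))
  have D10 := abs_Lpow_monomial_le hY hΛ hβ hLY hΨ₄ (h4 R₁₀ (Or.inr (Or.inr (Or.inr (Or.inl rfl)))))
  have D11 := abs_Lpow_monomial_le hY hΛ hβ hLY hΨ₄ (h4 R₁₁ (Or.inr (Or.inr (Or.inr (Or.inr (Or.inl rfl))))))
  have D20 := abs_Lpow_monomial_le hY hΛ hβ hLY hΨ₄ (h4 R₂₀ (Or.inr (Or.inr (Or.inr (Or.inr (Or.inr rfl))))))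
  have S00 := abs_Lpow_monomial_le hY hΛ hβ hLY hΨ₆ h6
  have B00 := abs_Lpow_monomial_le hY hΛ hβ hLY hΨB (hB R₀₀ (Or.inl rfl))
  have B01 := abs_Lpow_monomial_le hY hΛ hβ hLY hΨB (hB R₀₁ (Or.inr (Or.inl rfl)))
  have B02 := abs_Lpow_monomial_le hY hΛ hβ hLY hΨB (hB R₀₂ (Or.inr (Or.inr (Or.inl rfl))))
  have B10 := abs_Lpow_monomial_le hY hΛ hβ hLY hΨB (hB R₁₀ (Or.inr (Or.inr (Or.inr (Or.inl rfl)))))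
  have B11 := abs_Lpow_monomial_le hY hΛ hβ hLY hΨB (hB R₁₁ (Or.inr (Or.inr (Or.inr (Or.inr (Or.inl rfl))))))
  have B20 := abs_Lpow_monomial_le hY hΛ hβ hLY hΨB (hB R₂₀ (Or.inr (Or.inr (Or.inr (Or.inr (Or.inr rfl))))))
  have BD00 := abs_Lpow_monomial_le hY hΛ hβ hLY hΨBD hBD
  have g1 := G00 6 m₁ m₂ hm₁ hm₂
  have g2 := P00 4 m₁ m₂ hm₁ hm₂
  have g3 := P00 4 m₂ m₁ hm₂ hm₁
  have g4 := D00 2 m₁ m₂ hm₁ hm₂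
  have g5 := D00 2 m₂ m₁ hm₂ hm₁
  have g6 := B00 2 m₁ m₂ hm₁ hm₂
  have g7 := S00 0 m₁ m₂ hm₁ hm₂
  have g8 := S00 0 m₂ m₁ hm₂ hm₁
  have g9 := BD00 0 m₁ m₂ hm₁ hm₂
  have g10 := BD00 0 m₂ m₁ hm₂ hm₁
  have g11 := G01 5 m₁ m₂ hm₁ hm₂
  have g12 := P01 3 m₁ m₂ hm₁ hm₂
  have g13 := P01 3 m₂ m₁ hm₂ hm₁
  have g14 := D01 1 m₁ m₂ hm₁ hm₂
  have g15 := D01 1 m₂ m₁ hm₂ hm₁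
  have g16 := B01 1 m₁ m₂ hm₁ hm₂
  have g17 := G02 4 m₁ m₂ hm₁ hm₂
  have g18 := P02 2 m₁ m₂ hm₁ hm₂
  have g19 := P02 2 m₂ m₁ hm₂ hm₁
  have g20 := D02 0 m₁ m₂ hm₁ hm₂
  have g21 := D02 0 m₂ m₁ hm₂ hm₁
  have g22 := B02 0 m₁ m₂ hm₁ hm₂
  have g23 := G03 3 m₁ m₂ hm₁ hm₂
  have g24 := P03 1 m₁ m₂ hm₁ hm₂
  have g25 := P03 1 m₂ m₁ hm₂ hm₁
  have g26 := G04 2 m₁ m₂ hm₁ hm₂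
  have g27 := P04 0 m₁ m₂ hm₁ hm₂
  have g28 := P04 0 m₂ m₁ hm₂ hm₁
  have g29 := G10 5 m₁ m₂ hm₁ hm₂
  have g30 := P10 3 m₁ m₂ hm₁ hm₂
  have g31 := P10 3 m₂ m₁ hm₂ hm₁
  have g32 := D10 1 m₁ m₂ hm₁ hm₂
  have g33 := D10 1 m₂ m₁ hm₂ hm₁
  have g34 := B10 1 m₁ m₂ hm₁ hm₂
  have g35 := G11 4 m₁ m₂ hm₁ hm₂
  have g36 := D11 0 m₁ m₂ hm₁ hm₂
  have g37 := D11 0 m₂ m₁ hm₂ hm₁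
  have g38 := B11 0 m₁ m₂ hm₁ hm₂
  have g39 := G12 3 m₁ m₂ hm₁ hm₂
  have g40 := P12 1 m₁ m₂ hm₁ hm₂
  have g41 := P12 1 m₂ m₁ hm₂ hm₁
  have g42 := G13 2 m₁ m₂ hm₁ hm₂
  have g43 := P13 0 m₁ m₂ hm₁ hm₂
  have g44 := P13 0 m₂ m₁ hm₂ hm₁
  have g45 := G14 1 m₁ m₂ hm₁ hm₂
  have g46 := G20 4 m₁ m₂ hm₁ hm₂
  have g47 := P20 2 m₁ m₂ hm₁ hm₂
  have g48 := P20 2 m₂ m₁ hm₂ hm₁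
  have g49 := D20 0 m₁ m₂ hm₁ hm₂
  have g50 := D20 0 m₂ m₁ hm₂ hm₁
  have g51 := B20 0 m₁ m₂ hm₁ hm₂
  have g52 := G21 3 m₁ m₂ hm₁ hm₂
  have g53 := P21 1 m₁ m₂ hm₁ hm₂
  have g54 := P21 1 m₂ m₁ hm₂ hm₁
  have g55 := G22 2 m₁ m₂ hm₁ hm₂
  have g56 := P22 0 m₁ m₂ hm₁ hm₂
  have g57 := P22 0 m₂ m₁ hm₂ hm₁
  have g58 := G23 1 m₁ m₂ hm₁ hm₂
  have g59 := G24 0 m₁ m₂ hm₁ hm₂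
  rw [show m₂ + m₁ = m₁ + m₂ from add_comm _ _] at g3 g5 g8 g10 g13 g15 g19 g21 g25 g28 g31 g33 g37 g41 g44 g48 g50 g54 g57
  rw [← hI] at g1 g2 g3 g4 g5 g6 g7 g8 g9 g10 g11 g12 g13 g14 g15 g16 g17 g18 g19 g20 g21 g22 g23 g24 g25 g26 g27 g28 g29 g30 g31 g32 g33 g34 g35 g36 g37 g38 g39 g40 g41 g42 g43 g44 g45 g46 g47 g48 g49 g50 g51 g52 g53 g54 g55 g56 g57 g58 g59
  simp only [← hX₀, ← hX₂, ← hX₄, ← hX₆, ← hXB, ← hXBD] at g1 g2 g3 g4 g5 g6 g7 g8 g9 g10 g11 g12 g13 g14 g15 g16 g17 g18 g19 g20 g21 g22 g23 g24 g25 g26 g27 g28 g29 g30 g31 g32 g33 g34 g35 g36 g37 g38 g39 g40 g41 g42 g43 g44 g45 g46 g47 g48 g49 g50 g51 g52 g53 g54 g55 g56 g57 g58 g59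
  -- the decomposition of the weight into the 59 terms
  have hid : ∑ k₁ ∈ I, ∑ k₂ ∈ I,
      a k₁ * a k₂ * ellp Y k₁ ^ m₁ * ellp Y k₂ ^ m₂ *
        (((2 * β + ellp Y k₁ + ellp Y k₂) ^ 6 - (2 * β + ellp Y k₁ + ellp Y k₂) ^ 4 * (P2 k₁ + P2 k₂) - 3 * (2 * β + ellp Y k₁ + ellp Y k₂) ^ 2 * (P2 k₁ + P2 k₂) ^ 2 + 2 * (2 * β + ellp Y k₁ + ellp Y k₂) ^ 2 * (P4 k₁ + P4 k₂) + 15 * (P2 k₁ + P2 k₂) ^ 3 - 30 * (P2 k₁ + P2 k₂) * (P4 k₁ + P4 k₂) + 16 * (P6 k₁ + P6 k₂)) / 64 * R₀₀ (α * k₁ * k₂) +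
            ((2 * β + ellp Y k₁ + ellp Y k₂) ^ 5 - 2 * (2 * β + ellp Y k₁ + ellp Y k₂) ^ 3 * (P2 k₁ + P2 k₂) + 3 * (2 * β + ellp Y k₁ + ellp Y k₂) * (P2 k₁ + P2 k₂) ^ 2 - 2 * (2 * β + ellp Y k₁ + ellp Y k₂) * (P4 k₁ + P4 k₂)) / 8 * R₀₁ (α * k₁ * k₂) +
            (3 * (2 * β + ellp Y k₁ + ellp Y k₂) ^ 4 - 6 * (2 * β + ellp Y k₁ + ellp Y k₂) ^ 2 * (P2 k₁ + P2 k₂) + 9 * (P2 k₁ + P2 k₂) ^ 2 - 6 * (P4 k₁ + P4 k₂)) / 8 * R₀₂ (α * k₁ * k₂) +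
            ((2 * β + ellp Y k₁ + ellp Y k₂) ^ 3 - (2 * β + ellp Y k₁ + ellp Y k₂) * (P2 k₁ + P2 k₂)) / 2 * R₀₃ (α * k₁ * k₂) +
            ((2 * β + ellp Y k₁ + ellp Y k₂) ^ 2 + (P2 k₁ + P2 k₂)) / 4 * R₀₄ (α * k₁ * k₂) +
            ((2 * β + ellp Y k₁ + ellp Y k₂) ^ 5 + 2 * (2 * β + ellp Y k₁ + ellp Y k₂) ^ 3 * (P2 k₁ + P2 k₂) - 9 * (2 * β + ellp Y k₁ + ellp Y k₂) * (P2 k₁ + P2 k₂) ^ 2 + 6 * (2 * β + ellp Y k₁ + ellp Y k₂) * (P4 k₁ + P4 k₂)) / 16 * R₁₀ (α * k₁ * k₂) +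
            ((2 * β + ellp Y k₁ + ellp Y k₂) ^ 4 - 3 * (P2 k₁ + P2 k₂) ^ 2 + 2 * (P4 k₁ + P4 k₂)) / 2 * R₁₁ (α * k₁ * k₂) +
            (3 * (2 * β + ellp Y k₁ + ellp Y k₂) ^ 3 - 3 * (2 * β + ellp Y k₁ + ellp Y k₂) * (P2 k₁ + P2 k₂)) / 2 * R₁₂ (α * k₁ * k₂) +
            (2 * (2 * β + ellp Y k₁ + ellp Y k₂) ^ 2 - 2 * (P2 k₁ + P2 k₂)) * R₁₃ (α * k₁ * k₂) +
            (2 * β + ellp Y k₁ + ellp Y k₂) * R₁₄ (α * k₁ * k₂) +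
            ((2 * β + ellp Y k₁ + ellp Y k₂) ^ 4 + 6 * (2 * β + ellp Y k₁ + ellp Y k₂) ^ 2 * (P2 k₁ + P2 k₂) + 3 * (P2 k₁ + P2 k₂) ^ 2 - 2 * (P4 k₁ + P4 k₂)) / 16 * R₂₀ (α * k₁ * k₂) +
            ((2 * β + ellp Y k₁ + ellp Y k₂) ^ 3 + 3 * (2 * β + ellp Y k₁ + ellp Y k₂) * (P2 k₁ + P2 k₂)) / 2 * R₂₁ (α * k₁ * k₂) +
            (3 * (2 * β + ellp Y k₁ + ellp Y k₂) ^ 2 + 3 * (P2 k₁ + P2 k₂)) / 2 * R₂₂ (α * k₁ * k₂) + 2 * (2 * β + ellp Y k₁ + ellp Y k₂) * R₂₃ (α * k₁ * k₂) + R₂₄ (α * k₁ * k₂)) =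
      1 / 64 * ∑ k₁ ∈ I, ∑ k₂ ∈ I, a k₁ * a k₂ * ellp Y k₁ ^ m₁ * ellp Y k₂ ^ m₂ * ((2 * β + ellp Y k₁ + ellp Y k₂) ^ 6 * R₀₀ (α * k₁ * k₂)) -
      1 / 64 * ∑ k₁ ∈ I, ∑ k₂ ∈ I, a k₁ * (a k₂ * P2 k₂) * ellp Y k₁ ^ m₁ * ellp Y k₂ ^ m₂ * ((2 * β + ellp Y k₁ + ellp Y k₂) ^ 4 * R₀₀ (α * k₁ * k₂)) -
      1 / 64 * ∑ k₁ ∈ I, ∑ k₂ ∈ I, a k₁ * P2 k₁ * a k₂ * ellp Y k₁ ^ m₁ * ellp Y k₂ ^ m₂ * ((2 * β + ellp Y k₁ + ellp Y k₂) ^ 4 * R₀₀ (α * k₁ * k₂)) -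
      1 / 64 * ∑ k₁ ∈ I, ∑ k₂ ∈ I, a k₁ * (a k₂ * (3 * P2 k₂ ^ 2 - 2 * P4 k₂)) * ellp Y k₁ ^ m₁ * ellp Y k₂ ^ m₂ * ((2 * β + ellp Y k₁ + ellp Y k₂) ^ 2 * R₀₀ (α * k₁ * k₂)) -
      1 / 64 * ∑ k₁ ∈ I, ∑ k₂ ∈ I, a k₁ * (3 * P2 k₁ ^ 2 - 2 * P4 k₁) * a k₂ * ellp Y k₁ ^ m₁ * ellp Y k₂ ^ m₂ * ((2 * β + ellp Y k₁ + ellp Y k₂) ^ 2 * R₀₀ (α * k₁ * k₂)) -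
      3 / 32 * ∑ k₁ ∈ I, ∑ k₂ ∈ I, (a k₁ * P2 k₁) * (a k₂ * P2 k₂) * ellp Y k₁ ^ m₁ * ellp Y k₂ ^ m₂ * ((2 * β + ellp Y k₁ + ellp Y k₂) ^ 2 * R₀₀ (α * k₁ * k₂)) +
      1 / 64 * ∑ k₁ ∈ I, ∑ k₂ ∈ I, a k₁ * (a k₂ * (15 * P2 k₂ ^ 3 - 30 * P2 k₂ * P4 k₂ + 16 * P6 k₂)) * ellp Y k₁ ^ m₁ * ellp Y k₂ ^ m₂ * ((2 * β + ellp Y k₁ + ellp Y k₂) ^ 0 * R₀₀ (α * k₁ * k₂)) +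
      1 / 64 * ∑ k₁ ∈ I, ∑ k₂ ∈ I, a k₁ * (15 * P2 k₁ ^ 3 - 30 * P2 k₁ * P4 k₁ + 16 * P6 k₁) * a k₂ * ellp Y k₁ ^ m₁ * ellp Y k₂ ^ m₂ * ((2 * β + ellp Y k₁ + ellp Y k₂) ^ 0 * R₀₀ (α * k₁ * k₂)) +
      15 / 64 * ∑ k₁ ∈ I, ∑ k₂ ∈ I, (a k₁ * P2 k₁) * (a k₂ * (3 * P2 k₂ ^ 2 - 2 * P4 k₂)) * ellp Y k₁ ^ m₁ * ellp Y k₂ ^ m₂ * ((2 * β + ellp Y k₁ + ellp Y k₂) ^ 0 * R₀₀ (α * k₁ * k₂)) +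
      15 / 64 * ∑ k₁ ∈ I, ∑ k₂ ∈ I, (a k₁ * (3 * P2 k₁ ^ 2 - 2 * P4 k₁)) * (a k₂ * P2 k₂) * ellp Y k₁ ^ m₁ * ellp Y k₂ ^ m₂ * ((2 * β + ellp Y k₁ + ellp Y k₂) ^ 0 * R₀₀ (α * k₁ * k₂)) +
      1 / 8 * ∑ k₁ ∈ I, ∑ k₂ ∈ I, a k₁ * a k₂ * ellp Y k₁ ^ m₁ * ellp Y k₂ ^ m₂ * ((2 * β + ellp Y k₁ + ellp Y k₂) ^ 5 * R₀₁ (α * k₁ * k₂)) -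
      1 / 4 * ∑ k₁ ∈ I, ∑ k₂ ∈ I, a k₁ * (a k₂ * P2 k₂) * ellp Y k₁ ^ m₁ * ellp Y k₂ ^ m₂ * ((2 * β + ellp Y k₁ + ellp Y k₂) ^ 3 * R₀₁ (α * k₁ * k₂)) -
      1 / 4 * ∑ k₁ ∈ I, ∑ k₂ ∈ I, a k₁ * P2 k₁ * a k₂ * ellp Y k₁ ^ m₁ * ellp Y k₂ ^ m₂ * ((2 * β + ellp Y k₁ + ellp Y k₂) ^ 3 * R₀₁ (α * k₁ * k₂)) +
      1 / 8 * ∑ k₁ ∈ I, ∑ k₂ ∈ I, a k₁ * (a k₂ * (3 * P2 k₂ ^ 2 - 2 * P4 k₂)) * ellp Y k₁ ^ m₁ * ellp Y k₂ ^ m₂ * ((2 * β + ellp Y k₁ + ellp Y k₂) ^ 1 * R₀₁ (α * k₁ * k₂)) +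
      1 / 8 * ∑ k₁ ∈ I, ∑ k₂ ∈ I, a k₁ * (3 * P2 k₁ ^ 2 - 2 * P4 k₁) * a k₂ * ellp Y k₁ ^ m₁ * ellp Y k₂ ^ m₂ * ((2 * β + ellp Y k₁ + ellp Y k₂) ^ 1 * R₀₁ (α * k₁ * k₂)) +
      3 / 4 * ∑ k₁ ∈ I, ∑ k₂ ∈ I, (a k₁ * P2 k₁) * (a k₂ * P2 k₂) * ellp Y k₁ ^ m₁ * ellp Y k₂ ^ m₂ * ((2 * β + ellp Y k₁ + ellp Y k₂) ^ 1 * R₀₁ (α * k₁ * k₂)) +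
      3 / 8 * ∑ k₁ ∈ I, ∑ k₂ ∈ I, a k₁ * a k₂ * ellp Y k₁ ^ m₁ * ellp Y k₂ ^ m₂ * ((2 * β + ellp Y k₁ + ellp Y k₂) ^ 4 * R₀₂ (α * k₁ * k₂)) -
      3 / 4 * ∑ k₁ ∈ I, ∑ k₂ ∈ I, a k₁ * (a k₂ * P2 k₂) * ellp Y k₁ ^ m₁ * ellp Y k₂ ^ m₂ * ((2 * β + ellp Y k₁ + ellp Y k₂) ^ 2 * R₀₂ (α * k₁ * k₂)) -
      3 / 4 * ∑ k₁ ∈ I, ∑ k₂ ∈ I, a k₁ * P2 k₁ * a k₂ * ellp Y k₁ ^ m₁ * ellp Y k₂ ^ m₂ * ((2 * β + ellp Y k₁ + ellp Y k₂) ^ 2 * R₀₂ (α * k₁ * k₂)) +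
      3 / 8 * ∑ k₁ ∈ I, ∑ k₂ ∈ I, a k₁ * (a k₂ * (3 * P2 k₂ ^ 2 - 2 * P4 k₂)) * ellp Y k₁ ^ m₁ * ellp Y k₂ ^ m₂ * ((2 * β + ellp Y k₁ + ellp Y k₂) ^ 0 * R₀₂ (α * k₁ * k₂)) +
      3 / 8 * ∑ k₁ ∈ I, ∑ k₂ ∈ I, a k₁ * (3 * P2 k₁ ^ 2 - 2 * P4 k₁) * a k₂ * ellp Y k₁ ^ m₁ * ellp Y k₂ ^ m₂ * ((2 * β + ellp Y k₁ + ellp Y k₂) ^ 0 * R₀₂ (α * k₁ * k₂)) +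
      9 / 4 * ∑ k₁ ∈ I, ∑ k₂ ∈ I, (a k₁ * P2 k₁) * (a k₂ * P2 k₂) * ellp Y k₁ ^ m₁ * ellp Y k₂ ^ m₂ * ((2 * β + ellp Y k₁ + ellp Y k₂) ^ 0 * R₀₂ (α * k₁ * k₂)) +
      1 / 2 * ∑ k₁ ∈ I, ∑ k₂ ∈ I, a k₁ * a k₂ * ellp Y k₁ ^ m₁ * ellp Y k₂ ^ m₂ * ((2 * β + ellp Y k₁ + ellp Y k₂) ^ 3 * R₀₃ (α * k₁ * k₂)) -
      1 / 2 * ∑ k₁ ∈ I, ∑ k₂ ∈ I, a k₁ * (a k₂ * P2 k₂) * ellp Y k₁ ^ m₁ * ellp Y k₂ ^ m₂ * ((2 * β + ellp Y k₁ + ellp Y k₂) ^ 1 * R₀₃ (α * k₁ * k₂)) -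
      1 / 2 * ∑ k₁ ∈ I, ∑ k₂ ∈ I, a k₁ * P2 k₁ * a k₂ * ellp Y k₁ ^ m₁ * ellp Y k₂ ^ m₂ * ((2 * β + ellp Y k₁ + ellp Y k₂) ^ 1 * R₀₃ (α * k₁ * k₂)) +
      1 / 4 * ∑ k₁ ∈ I, ∑ k₂ ∈ I, a k₁ * a k₂ * ellp Y k₁ ^ m₁ * ellp Y k₂ ^ m₂ * ((2 * β + ellp Y k₁ + ellp Y k₂) ^ 2 * R₀₄ (α * k₁ * k₂)) +
      1 / 4 * ∑ k₁ ∈ I, ∑ k₂ ∈ I, a k₁ * (a k₂ * P2 k₂) * ellp Y k₁ ^ m₁ * ellp Y k₂ ^ m₂ * ((2 * β + ellp Y k₁ + ellp Y k₂) ^ 0 * R₀₄ (α * k₁ * k₂)) +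
      1 / 4 * ∑ k₁ ∈ I, ∑ k₂ ∈ I, a k₁ * P2 k₁ * a k₂ * ellp Y k₁ ^ m₁ * ellp Y k₂ ^ m₂ * ((2 * β + ellp Y k₁ + ellp Y k₂) ^ 0 * R₀₄ (α * k₁ * k₂)) +
      1 / 16 * ∑ k₁ ∈ I, ∑ k₂ ∈ I, a k₁ * a k₂ * ellp Y k₁ ^ m₁ * ellp Y k₂ ^ m₂ * ((2 * β + ellp Y k₁ + ellp Y k₂) ^ 5 * R₁₀ (α * k₁ * k₂)) +
      1 / 8 * ∑ k₁ ∈ I, ∑ k₂ ∈ I, a k₁ * (a k₂ * P2 k₂) * ellp Y k₁ ^ m₁ * ellp Y k₂ ^ m₂ * ((2 * β + ellp Y k₁ + ellp Y k₂) ^ 3 * R₁₀ (α * k₁ * k₂)) +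
      1 / 8 * ∑ k₁ ∈ I, ∑ k₂ ∈ I, a k₁ * P2 k₁ * a k₂ * ellp Y k₁ ^ m₁ * ellp Y k₂ ^ m₂ * ((2 * β + ellp Y k₁ + ellp Y k₂) ^ 3 * R₁₀ (α * k₁ * k₂)) -
      3 / 16 * ∑ k₁ ∈ I, ∑ k₂ ∈ I, a k₁ * (a k₂ * (3 * P2 k₂ ^ 2 - 2 * P4 k₂)) * ellp Y k₁ ^ m₁ * ellp Y k₂ ^ m₂ * ((2 * β + ellp Y k₁ + ellp Y k₂) ^ 1 * R₁₀ (α * k₁ * k₂)) -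
      3 / 16 * ∑ k₁ ∈ I, ∑ k₂ ∈ I, a k₁ * (3 * P2 k₁ ^ 2 - 2 * P4 k₁) * a k₂ * ellp Y k₁ ^ m₁ * ellp Y k₂ ^ m₂ * ((2 * β + ellp Y k₁ + ellp Y k₂) ^ 1 * R₁₀ (α * k₁ * k₂)) -
      9 / 8 * ∑ k₁ ∈ I, ∑ k₂ ∈ I, (a k₁ * P2 k₁) * (a k₂ * P2 k₂) * ellp Y k₁ ^ m₁ * ellp Y k₂ ^ m₂ * ((2 * β + ellp Y k₁ + ellp Y k₂) ^ 1 * R₁₀ (α * k₁ * k₂)) +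
      1 / 2 * ∑ k₁ ∈ I, ∑ k₂ ∈ I, a k₁ * a k₂ * ellp Y k₁ ^ m₁ * ellp Y k₂ ^ m₂ * ((2 * β + ellp Y k₁ + ellp Y k₂) ^ 4 * R₁₁ (α * k₁ * k₂)) -
      1 / 2 * ∑ k₁ ∈ I, ∑ k₂ ∈ I, a k₁ * (a k₂ * (3 * P2 k₂ ^ 2 - 2 * P4 k₂)) * ellp Y k₁ ^ m₁ * ellp Y k₂ ^ m₂ * ((2 * β + ellp Y k₁ + ellp Y k₂) ^ 0 * R₁₁ (α * k₁ * k₂)) -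
      1 / 2 * ∑ k₁ ∈ I, ∑ k₂ ∈ I, a k₁ * (3 * P2 k₁ ^ 2 - 2 * P4 k₁) * a k₂ * ellp Y k₁ ^ m₁ * ellp Y k₂ ^ m₂ * ((2 * β + ellp Y k₁ + ellp Y k₂) ^ 0 * R₁₁ (α * k₁ * k₂)) -
      3 * ∑ k₁ ∈ I, ∑ k₂ ∈ I, (a k₁ * P2 k₁) * (a k₂ * P2 k₂) * ellp Y k₁ ^ m₁ * ellp Y k₂ ^ m₂ * ((2 * β + ellp Y k₁ + ellp Y k₂) ^ 0 * R₁₁ (α * k₁ * k₂)) +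
      3 / 2 * ∑ k₁ ∈ I, ∑ k₂ ∈ I, a k₁ * a k₂ * ellp Y k₁ ^ m₁ * ellp Y k₂ ^ m₂ * ((2 * β + ellp Y k₁ + ellp Y k₂) ^ 3 * R₁₂ (α * k₁ * k₂)) -
      3 / 2 * ∑ k₁ ∈ I, ∑ k₂ ∈ I, a k₁ * (a k₂ * P2 k₂) * ellp Y k₁ ^ m₁ * ellp Y k₂ ^ m₂ * ((2 * β + ellp Y k₁ + ellp Y k₂) ^ 1 * R₁₂ (α * k₁ * k₂)) -
      3 / 2 * ∑ k₁ ∈ I, ∑ k₂ ∈ I, a k₁ * P2 k₁ * a k₂ * ellp Y k₁ ^ m₁ * ellp Y k₂ ^ m₂ * ((2 * β + ellp Y k₁ + ellp Y k₂) ^ 1 * R₁₂ (α * k₁ * k₂)) +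
      2 * ∑ k₁ ∈ I, ∑ k₂ ∈ I, a k₁ * a k₂ * ellp Y k₁ ^ m₁ * ellp Y k₂ ^ m₂ * ((2 * β + ellp Y k₁ + ellp Y k₂) ^ 2 * R₁₃ (α * k₁ * k₂)) -
      2 * ∑ k₁ ∈ I, ∑ k₂ ∈ I, a k₁ * (a k₂ * P2 k₂) * ellp Y k₁ ^ m₁ * ellp Y k₂ ^ m₂ * ((2 * β + ellp Y k₁ + ellp Y k₂) ^ 0 * R₁₃ (α * k₁ * k₂)) -
      2 * ∑ k₁ ∈ I, ∑ k₂ ∈ I, a k₁ * P2 k₁ * a k₂ * ellp Y k₁ ^ m₁ * ellp Y k₂ ^ m₂ * ((2 * β + ellp Y k₁ + ellp Y k₂) ^ 0 * R₁₃ (α * k₁ * k₂)) +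
      1 * ∑ k₁ ∈ I, ∑ k₂ ∈ I, a k₁ * a k₂ * ellp Y k₁ ^ m₁ * ellp Y k₂ ^ m₂ * ((2 * β + ellp Y k₁ + ellp Y k₂) ^ 1 * R₁₄ (α * k₁ * k₂)) +
      1 / 16 * ∑ k₁ ∈ I, ∑ k₂ ∈ I, a k₁ * a k₂ * ellp Y k₁ ^ m₁ * ellp Y k₂ ^ m₂ * ((2 * β + ellp Y k₁ + ellp Y k₂) ^ 4 * R₂₀ (α * k₁ * k₂)) +
      3 / 8 * ∑ k₁ ∈ I, ∑ k₂ ∈ I, a k₁ * (a k₂ * P2 k₂) * ellp Y k₁ ^ m₁ * ellp Y k₂ ^ m₂ * ((2 * β + ellp Y k₁ + ellp Y k₂) ^ 2 * R₂₀ (α * k₁ * k₂)) +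
      3 / 8 * ∑ k₁ ∈ I, ∑ k₂ ∈ I, a k₁ * P2 k₁ * a k₂ * ellp Y k₁ ^ m₁ * ellp Y k₂ ^ m₂ * ((2 * β + ellp Y k₁ + ellp Y k₂) ^ 2 * R₂₀ (α * k₁ * k₂)) +
      1 / 16 * ∑ k₁ ∈ I, ∑ k₂ ∈ I, a k₁ * (a k₂ * (3 * P2 k₂ ^ 2 - 2 * P4 k₂)) * ellp Y k₁ ^ m₁ * ellp Y k₂ ^ m₂ * ((2 * β + ellp Y k₁ + ellp Y k₂) ^ 0 * R₂₀ (α * k₁ * k₂)) +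
      1 / 16 * ∑ k₁ ∈ I, ∑ k₂ ∈ I, a k₁ * (3 * P2 k₁ ^ 2 - 2 * P4 k₁) * a k₂ * ellp Y k₁ ^ m₁ * ellp Y k₂ ^ m₂ * ((2 * β + ellp Y k₁ + ellp Y k₂) ^ 0 * R₂₀ (α * k₁ * k₂)) +
      3 / 8 * ∑ k₁ ∈ I, ∑ k₂ ∈ I, (a k₁ * P2 k₁) * (a k₂ * P2 k₂) * ellp Y k₁ ^ m₁ * ellp Y k₂ ^ m₂ * ((2 * β + ellp Y k₁ + ellp Y k₂) ^ 0 * R₂₀ (α * k₁ * k₂)) +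
      1 / 2 * ∑ k₁ ∈ I, ∑ k₂ ∈ I, a k₁ * a k₂ * ellp Y k₁ ^ m₁ * ellp Y k₂ ^ m₂ * ((2 * β + ellp Y k₁ + ellp Y k₂) ^ 3 * R₂₁ (α * k₁ * k₂)) +
      3 / 2 * ∑ k₁ ∈ I, ∑ k₂ ∈ I, a k₁ * (a k₂ * P2 k₂) * ellp Y k₁ ^ m₁ * ellp Y k₂ ^ m₂ * ((2 * β + ellp Y k₁ + ellp Y k₂) ^ 1 * R₂₁ (α * k₁ * k₂)) +
      3 / 2 * ∑ k₁ ∈ I, ∑ k₂ ∈ I, a k₁ * P2 k₁ * a k₂ * ellp Y k₁ ^ m₁ * ellp Y k₂ ^ m₂ * ((2 * β + ellp Y k₁ + ellp Y k₂) ^ 1 * R₂₁ (α * k₁ * k₂)) +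
      3 / 2 * ∑ k₁ ∈ I, ∑ k₂ ∈ I, a k₁ * a k₂ * ellp Y k₁ ^ m₁ * ellp Y k₂ ^ m₂ * ((2 * β + ellp Y k₁ + ellp Y k₂) ^ 2 * R₂₂ (α * k₁ * k₂)) +
      3 / 2 * ∑ k₁ ∈ I, ∑ k₂ ∈ I, a k₁ * (a k₂ * P2 k₂) * ellp Y k₁ ^ m₁ * ellp Y k₂ ^ m₂ * ((2 * β + ellp Y k₁ + ellp Y k₂) ^ 0 * R₂₂ (α * k₁ * k₂)) +
      3 / 2 * ∑ k₁ ∈ I, ∑ k₂ ∈ I, a k₁ * P2 k₁ * a k₂ * ellp Y k₁ ^ m₁ * ellp Y k₂ ^ m₂ * ((2 * β + ellp Y k₁ + ellp Y k₂) ^ 0 * R₂₂ (α * k₁ * k₂)) +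
      2 * ∑ k₁ ∈ I, ∑ k₂ ∈ I, a k₁ * a k₂ * ellp Y k₁ ^ m₁ * ellp Y k₂ ^ m₂ * ((2 * β + ellp Y k₁ + ellp Y k₂) ^ 1 * R₂₃ (α * k₁ * k₂)) +
      1 * ∑ k₁ ∈ I, ∑ k₂ ∈ I, a k₁ * a k₂ * ellp Y k₁ ^ m₁ * ellp Y k₂ ^ m₂ * ((2 * β + ellp Y k₁ + ellp Y k₂) ^ 0 * R₂₄ (α * k₁ * k₂)) := by
    simp (maxSteps := 4000000) only [Finset.mul_sum, ← Finset.sum_add_distrib, ← Finset.sum_sub_distrib]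
    refine Finset.sum_congr rfl fun k₁ _ ↦ Finset.sum_congr rfl fun k₂ _ ↦ ?_
    ring
  rw [hid]
  -- move the row decorations to the column
  have hsw1 : ∑ k₁ ∈ I, ∑ k₂ ∈ I, a k₁ * (3 * P2 k₁ ^ 2 - 2 * P4 k₁) * a k₂ * ellp Y k₁ ^ m₁ * ellp Y k₂ ^ m₂ * ((2 * β + ellp Y k₁ + ellp Y k₂) ^ 2 * R₀₀ (α * k₁ * k₂)) =
      ∑ k₁ ∈ I, ∑ k₂ ∈ I, a k₁ * (a k₂ * (3 * P2 k₂ ^ 2 - 2 * P4 k₂)) * ellp Y k₁ ^ m₂ * ellp Y k₂ ^ m₁ * ((2 * β + ellp Y k₁ + ellp Y k₂) ^ 2 * R₀₀ (α * k₁ * k₂)) := sum_swap_decor_Lpow a (fun k ↦ 3 * P2 k ^ 2 - 2 * P4 k) R₀₀ Y α β m₁ m₂ 2 I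
  have hsw2 : ∑ k₁ ∈ I, ∑ k₂ ∈ I, a k₁ * (15 * P2 k₁ ^ 3 - 30 * P2 k₁ * P4 k₁ + 16 * P6 k₁) * a k₂ * ellp Y k₁ ^ m₁ * ellp Y k₂ ^ m₂ * ((2 * β + ellp Y k₁ + ellp Y k₂) ^ 0 * R₀₀ (α * k₁ * k₂)) =
      ∑ k₁ ∈ I, ∑ k₂ ∈ I, a k₁ * (a k₂ * (15 * P2 k₂ ^ 3 - 30 * P2 k₂ * P4 k₂ + 16 * P6 k₂)) * ellp Y k₁ ^ m₂ * ellp Y k₂ ^ m₁ * ((2 * β + ellp Y k₁ + ellp Y k₂) ^ 0 * R₀₀ (α * k₁ * k₂)) := sum_swap_decor_Lpow a (fun k ↦ 15 * P2 k ^ 3 - 30 * P2 k * P4 k + 16 * P6 k) R₀₀ Y α β m₁ m₂ 0 I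
  have hsw3 : ∑ k₁ ∈ I, ∑ k₂ ∈ I, (a k₁ * (3 * P2 k₁ ^ 2 - 2 * P4 k₁)) * (a k₂ * P2 k₂) * ellp Y k₁ ^ m₁ * ellp Y k₂ ^ m₂ * ((2 * β + ellp Y k₁ + ellp Y k₂) ^ 0 * R₀₀ (α * k₁ * k₂)) =
      ∑ k₁ ∈ I, ∑ k₂ ∈ I, (a k₁ * P2 k₁) * (a k₂ * (3 * P2 k₂ ^ 2 - 2 * P4 k₂)) * ellp Y k₁ ^ m₂ * ellp Y k₂ ^ m₁ * ((2 * β + ellp Y k₁ + ellp Y k₂) ^ 0 * R₀₀ (α * k₁ * k₂)) := sum_swap_both_Lpow a (fun k ↦ 3 * P2 k ^ 2 - 2 * P4 k) P2 R₀₀ Y α β m₁ m₂ 0 I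
  have hsw4 : ∑ k₁ ∈ I, ∑ k₂ ∈ I, a k₁ * (3 * P2 k₁ ^ 2 - 2 * P4 k₁) * a k₂ * ellp Y k₁ ^ m₁ * ellp Y k₂ ^ m₂ * ((2 * β + ellp Y k₁ + ellp Y k₂) ^ 1 * R₀₁ (α * k₁ * k₂)) =
      ∑ k₁ ∈ I, ∑ k₂ ∈ I, a k₁ * (a k₂ * (3 * P2 k₂ ^ 2 - 2 * P4 k₂)) * ellp Y k₁ ^ m₂ * ellp Y k₂ ^ m₁ * ((2 * β + ellp Y k₁ + ellp Y k₂) ^ 1 * R₀₁ (α * k₁ * k₂)) := sum_swap_decor_Lpow a (fun k ↦ 3 * P2 k ^ 2 - 2 * P4 k) R₀₁ Y α β m₁ m₂ 1 I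
  have hsw5 : ∑ k₁ ∈ I, ∑ k₂ ∈ I, a k₁ * (3 * P2 k₁ ^ 2 - 2 * P4 k₁) * a k₂ * ellp Y k₁ ^ m₁ * ellp Y k₂ ^ m₂ * ((2 * β + ellp Y k₁ + ellp Y k₂) ^ 0 * R₀₂ (α * k₁ * k₂)) =
      ∑ k₁ ∈ I, ∑ k₂ ∈ I, a k₁ * (a k₂ * (3 * P2 k₂ ^ 2 - 2 * P4 k₂)) * ellp Y k₁ ^ m₂ * ellp Y k₂ ^ m₁ * ((2 * β + ellp Y k₁ + ellp Y k₂) ^ 0 * R₀₂ (α * k₁ * k₂)) := sum_swap_decor_Lpow a (fun k ↦ 3 * P2 k ^ 2 - 2 * P4 k) R₀₂ Y α β m₁ m₂ 0 I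
  have hsw6 : ∑ k₁ ∈ I, ∑ k₂ ∈ I, a k₁ * (3 * P2 k₁ ^ 2 - 2 * P4 k₁) * a k₂ * ellp Y k₁ ^ m₁ * ellp Y k₂ ^ m₂ * ((2 * β + ellp Y k₁ + ellp Y k₂) ^ 1 * R₁₀ (α * k₁ * k₂)) =
      ∑ k₁ ∈ I, ∑ k₂ ∈ I, a k₁ * (a k₂ * (3 * P2 k₂ ^ 2 - 2 * P4 k₂)) * ellp Y k₁ ^ m₂ * ellp Y k₂ ^ m₁ * ((2 * β + ellp Y k₁ + ellp Y k₂) ^ 1 * R₁₀ (α * k₁ * k₂)) := sum_swap_decor_Lpow a (fun k ↦ 3 * P2 k ^ 2 - 2 * P4 k) R₁₀ Y α β m₁ m₂ 1 I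
  have hsw7 : ∑ k₁ ∈ I, ∑ k₂ ∈ I, a k₁ * (3 * P2 k₁ ^ 2 - 2 * P4 k₁) * a k₂ * ellp Y k₁ ^ m₁ * ellp Y k₂ ^ m₂ * ((2 * β + ellp Y k₁ + ellp Y k₂) ^ 0 * R₁₁ (α * k₁ * k₂)) =
      ∑ k₁ ∈ I, ∑ k₂ ∈ I, a k₁ * (a k₂ * (3 * P2 k₂ ^ 2 - 2 * P4 k₂)) * ellp Y k₁ ^ m₂ * ellp Y k₂ ^ m₁ * ((2 * β + ellp Y k₁ + ellp Y k₂) ^ 0 * R₁₁ (α * k₁ * k₂)) := sum_swap_decor_Lpow a (fun k ↦ 3 * P2 k ^ 2 - 2 * P4 k) R₁₁ Y α β m₁ m₂ 0 I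
  have hsw8 : ∑ k₁ ∈ I, ∑ k₂ ∈ I, a k₁ * (3 * P2 k₁ ^ 2 - 2 * P4 k₁) * a k₂ * ellp Y k₁ ^ m₁ * ellp Y k₂ ^ m₂ * ((2 * β + ellp Y k₁ + ellp Y k₂) ^ 0 * R₂₀ (α * k₁ * k₂)) =
      ∑ k₁ ∈ I, ∑ k₂ ∈ I, a k₁ * (a k₂ * (3 * P2 k₂ ^ 2 - 2 * P4 k₂)) * ellp Y k₁ ^ m₂ * ellp Y k₂ ^ m₁ * ((2 * β + ellp Y k₁ + ellp Y k₂) ^ 0 * R₂₀ (α * k₁ * k₂)) := sum_swap_decor_Lpow a (fun k ↦ 3 * P2 k ^ 2 - 2 * P4 k) R₂₀ Y α β m₁ m₂ 0 I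
  rw [sum_swap_decor_Lpow a P2 R₀₀ Y α β m₁ m₂ 4 I,
    hsw1,
    hsw2,
    hsw3,
    sum_swap_decor_Lpow a P2 R₀₁ Y α β m₁ m₂ 3 I,
    hsw4,
    sum_swap_decor_Lpow a P2 R₀₂ Y α β m₁ m₂ 2 I,
    hsw5,
    sum_swap_decor_Lpow a P2 R₀₃ Y α β m₁ m₂ 1 I,
    sum_swap_decor_Lpow a P2 R₀₄ Y α β m₁ m₂ 0 I,
    sum_swap_decor_Lpow a P2 R₁₀ Y α β m₁ m₂ 3 I,
    hsw6,
    hsw7,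
    sum_swap_decor_Lpow a P2 R₁₂ Y α β m₁ m₂ 1 I,
    sum_swap_decor_Lpow a P2 R₁₃ Y α β m₁ m₂ 0 I,
    sum_swap_decor_Lpow a P2 R₂₀ Y α β m₁ m₂ 2 I,
    hsw8,
    sum_swap_decor_Lpow a P2 R₂₁ Y α β m₁ m₂ 1 I,
    sum_swap_decor_Lpow a P2 R₂₂ Y α β m₁ m₂ 0 I]
  -- numerics of the prefactors
  have hΛ1 : Λ ≤ Λ ^ 6 := le_self_pow₀ hΛ (by norm_num)
  have hΛ2 : Λ ^ 2 ≤ Λ ^ 6 := pow_le_pow_right₀ hΛ (by norm_num)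
  have hΛ3 : Λ ^ 3 ≤ Λ ^ 6 := pow_le_pow_right₀ hΛ (by norm_num)
  have hΛ4 : Λ ^ 4 ≤ Λ ^ 6 := pow_le_pow_right₀ hΛ (by norm_num)
  have hΛ5 : Λ ^ 5 ≤ Λ ^ 6 := pow_le_pow_right₀ hΛ (by norm_num)
  have hΛ06 : 1 ≤ Λ ^ 6 := one_le_pow₀ hΛ
  have hΛ14 : Λ ≤ Λ ^ 4 := le_self_pow₀ hΛ (by norm_num)
  have hΛ24 : Λ ^ 2 ≤ Λ ^ 4 := pow_le_pow_right₀ hΛ (by norm_num)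
  have hΛ34 : Λ ^ 3 ≤ Λ ^ 4 := pow_le_pow_right₀ hΛ (by norm_num)
  have hΛ04 : 1 ≤ Λ ^ 4 := one_le_pow₀ hΛ
  have hΛ12 : Λ ≤ Λ ^ 2 := le_self_pow₀ hΛ (by norm_num)
  have hΛ02 : 1 ≤ Λ ^ 2 := one_le_pow₀ hΛ
  have e6 : (4 * Λ) ^ 6 = 4096 * Λ ^ 6 := by ring
  have e5 : (4 * Λ) ^ 5 = 1024 * Λ ^ 5 := by ring
  have e4 : (4 * Λ) ^ 4 = 256 * Λ ^ 4 := by ring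
  have e3 : (4 * Λ) ^ 3 = 64 * Λ ^ 3 := by ring
  have e2 : (4 * Λ) ^ 2 = 16 * Λ ^ 2 := by ring
  have e1 : (4 * Λ) ^ 1 = 4 * Λ := by ring
  have e0 : (4 * Λ) ^ 0 = 1 := by ring
  rw [e6] at g1
  rw [e5] at g11 g29
  rw [e4] at g2 g3 g17 g35 g46
  rw [e3] at g12 g13 g23 g30 g31 g39 g52
  rw [e2] at g4 g5 g6 g18 g19 g26 g42 g47 g48 g55
  rw [e1] at g14 g15 g16 g24 g25 g32 g33 g34 g40 g41 g45 g53 g54 g58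
  rw [e0] at g7 g8 g9 g10 g20 g21 g22 g27 g28 g36 g37 g38 g43 g44 g49 g50 g51 g56 g57 g59
  have k01 : Λ ^ 5 * X₀ ≤ Λ ^ 6 * X₀ := mul_le_mul_of_nonneg_right hΛ5 hX₀0
  have k02 : Λ ^ 4 * X₀ ≤ Λ ^ 6 * X₀ := mul_le_mul_of_nonneg_right hΛ4 hX₀0
  have k03 : Λ ^ 3 * X₀ ≤ Λ ^ 6 * X₀ := mul_le_mul_of_nonneg_right hΛ3 hX₀0
  have k04 : Λ ^ 2 * X₀ ≤ Λ ^ 6 * X₀ := mul_le_mul_of_nonneg_right hΛ2 hX₀0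
  have k05 : Λ * X₀ ≤ Λ ^ 6 * X₀ := mul_le_mul_of_nonneg_right hΛ1 hX₀0
  have k06 : 1 * X₀ ≤ Λ ^ 6 * X₀ := mul_le_mul_of_nonneg_right hΛ06 hX₀0
  have k21 : Λ ^ 3 * X₂ ≤ Λ ^ 4 * X₂ := mul_le_mul_of_nonneg_right hΛ34 hX₂0
  have k22 : Λ ^ 2 * X₂ ≤ Λ ^ 4 * X₂ := mul_le_mul_of_nonneg_right hΛ24 hX₂0
  have k23 : Λ * X₂ ≤ Λ ^ 4 * X₂ := mul_le_mul_of_nonneg_right hΛ14 hX₂0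
  have k24 : 1 * X₂ ≤ Λ ^ 4 * X₂ := mul_le_mul_of_nonneg_right hΛ04 hX₂0
  have k41 : Λ * X₄ ≤ Λ ^ 2 * X₄ := mul_le_mul_of_nonneg_right hΛ12 hX₄0
  have k42 : 1 * X₄ ≤ Λ ^ 2 * X₄ := mul_le_mul_of_nonneg_right hΛ02 hX₄0
  have kB1 : Λ * XB ≤ Λ ^ 2 * XB := mul_le_mul_of_nonneg_right hΛ12 hXB0
  have kB2 : 1 * XB ≤ Λ ^ 2 * XB := mul_le_mul_of_nonneg_right hΛ02 hXB0
  have htot : (729 * Λ ^ 6 * Ψ₀ + 140 * Λ ^ 4 * Ψ₂ + 5 * Λ ^ 2 * Ψ₄ + Ψ₆ + 15 * Λ ^ 2 * ΨB + ΨBD) * Real.log Y ^ (m₁ + m₂) =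
      729 * (Λ ^ 6 * X₀) + 140 * (Λ ^ 4 * X₂) + 5 * (Λ ^ 2 * X₄) + X₆ + 15 * (Λ ^ 2 * XB) + XBD := by
    rw [hX₀, hX₂, hX₄, hX₆, hXB, hXBD]; ring
  rw [htot]
  rw [abs_le] at g1 g2 g3 g4 g5 g6 g7 g8 g9 g10 g11 g12 g13 g14 g15 g16 g17 g18 g19 g20 g21 g22 g23 g24 g25 g26 g27 g28 g29 g30 g31 g32 g33 g34 g35 g36 g37 g38 g39 g40 g41 g42 g43 g44 g45 g46 g47 g48 g49 g50 g51 g52 g53 g54 g55 g56 g57 g58 g59 ⊢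
  constructor <;> linarith [g1.1, g1.2, g2.1, g2.2, g3.1, g3.2, g4.1, g4.2, g5.1, g5.2, g6.1, g6.2, g7.1, g7.2, g8.1, g8.2, g9.1, g9.2, g10.1, g10.2, g11.1, g11.2, g12.1, g12.2, g13.1, g13.2, g14.1, g14.2, g15.1, g15.2, g16.1, g16.2, g17.1, g17.2, g18.1, g18.2, g19.1, g19.2, g20.1, g20.2, g21.1, g21.2, g22.1, g22.2, g23.1, g23.2, g24.1, g24.2, g25.1, g25.2, g26.1, g26.2, g27.1, g27.2, g28.1, g28.2, g29.1, g29.2, g30.1, g30.2, g31.1, g31.2, g32.1, g32.2, g33.1, g33.2, g34.1, g34.2, g35.1, g35.2, g36.1, g36.2, g37.1, g37.2, g38.1, g38.2, g39.1, g39.2, g40.1, g40.2, g41.1, g41.2, g42.1, g42.2, g43.1, g43.2, g44.1, g44.2, g45.1, g45.2, g46.1, g46.2, g47.1, g47.2, g48.1, g48.2, g49.1, g49.2, g50.1, g50.2, g51.1, g51.2, g52.1, g52.2, g53.1, g53.2, g54.1, g54.2, g55.1, g55.2, g56.1, g56.2, g57.1, g57.2, g58.1, g58.2, g59.1, g59.2,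 k01, k02, k03, k04, k05, k06, k21, k22, k23, k24,
    k41, k42, kB1, kB2, hX₀0, hX₂0, hX₄0, hX₆0, hXB0, hXBD0]

end Summit.Parity.GeneralizedHardyLittlewood.Theorems.MomentsBeyondDiagonal.DiagCorner

end
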